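import Summits.Ventures.PercRepro.ProfilePointedCircuitClassesGenericTwoII

/-!
# PercRepro — THE CLASS `#C = ν − 2` AT EVERY NULLITY, III: TYPE (iii) (p5, gen 37; generic in `ν ≥ 3`)

`card_typeIII_gen_le`: a demand `W' = C + σ + q'` with `#(W' ∩ W) = ν − 1` goes to `(V − q') + t_σ(q')` with two
distinct valid points `t_p(q') ≠ t_q(q')` of `T` off `cl(V − q')`; the image meets `T` in one point.
-/

open scoped Matroid

namespace PercRepro.Cogirth

open Finset ThmH Skew Shadow Profile

variable {α : Type} [DecidableEq α] {N : Matroid α} [N.Finite]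

section GenericTwoIII

/-- **THE TYPE-(iii) DEMANDS** (`#(W' ∩ W) = ν − 1`, `W' = C + σ + q'`, `σ ∈ W ∖ C = {p, q}`; the class `#C = ν − 2` at every nullity `ν ≥ 3`): `W' ↦ (V − q') + t_σ(q')`
with `t_p(q') ≠ t_q(q')` two points of `T` off `cl(V − q')` (`ta`, `tb`); the image meets `T` in one point and
determines `q' ∈ V ∖ image` and `t ∈ image ∖ V`. -/
theorem card_typeIII_gen_le
    {ν : ℕ} (hν : 3 ≤ ν) (hn : (gr N).card = rk N (gr N) + ν) (x : α) {C W V : Finset α} (Dv Uw : Finset (Finset α))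
    (hC : C.card = ν - 2) (_hWcard : W.card = ν) (hxV : x ∉ V) (hVg : V ⊆ gr N) (hVE : V ⊆ (gr N).erase x) (hVcard : V.card = (gr N).card - (ν + 1)) (hVrk : rk N V = V.card)
    (hCW : C ⊆ W) (hTν : ((gr N).erase x \ V).card = ν) (hTg : (gr N).erase x \ V ⊆ gr N)
    (hTV : ∀ t ∈ (gr N).erase x \ V, t ∉ V) (hTW : ∀ t ∈ (gr N).erase x \ V, t ∉ W)
    (hdem' : ∀ W' ∈ Dv, C ⊆ W' ∧ W'.card = ν ∧ W' ⊆ V ∧ rk N (gr N \ W') = (gr N \ W').card)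
    (hspan' : ∀ W' ∈ Dv, ∀ S ⊆ W', rk N (gr N \ S) = rk N (gr N))
    (hunit' : ∀ T' : Finset α, T' ⊆ (gr N).erase x \ W → T'.card = ν →
      rk N (gr N) ≤ rk N (gr N \ T') + 1 → (gr N).erase x \ T' ∈ Uw)
    {p q : α} (hpq : p ≠ q) (hWC : W \ C = {p, q}) (ta tb : α → α)
    (hta : ∀ q' ∈ V, q' ∉ C → rk N ((gr N).erase q') = rk N (gr N) →
      ta q' ∈ ((gr N).erase x \ V).filter (fun t => t ∉ clF N (V.erase q')) ∧
      tb q' ∈ ((gr N).erase x \ V).filter (fun t => t ∉ clF N (V.erase q')) ∧ ta q' ≠ tb q') :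
    (Dv.filter (fun W' => ¬ W' = W ∧ (W' ∩ W).card = ν - 1)).card ≤
      (Uw.filter (fun V' => (V' ∩ ((gr N).erase x \ V)).card = 1)).card := by
  apply card_le_card_of_forall_subsingleton (fun W' V' => ∃ q', W' \ W = {q'} ∧ V \ V' = {q'} ∧
    ((p ∈ W' ∧ V' \ V = {ta q'}) ∨ (q ∈ W' ∧ V' \ V = {tb q'})))
  · intro W' hW'
    rw [mem_filter] at hW'
    obtain ⟨hW'Dv, hne, h4⟩ := hW'
    obtain ⟨hCW', hc', hsub', hcompl'⟩ := hdem' W' hW'Dv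
    -- the new point `q'`: `W' ∖ W` is a singleton
    have hI4 : (W ∩ W').card = ν - 1 := by rw [inter_comm]; exact h4
    have h1 : (W' \ W).card = 1 := by
      rw [card_sdiff, hI4, hc']
      omega
    obtain ⟨q', hq'⟩ := card_eq_one.1 h1
    have hq'W' : q' ∈ W' := (mem_sdiff.1 (hq' ▸ mem_singleton_self q')).1
    have hq'W : q' ∉ W := (mem_sdiff.1 (hq' ▸ mem_singleton_self q')).2
    have hq'V : q' ∈ V := hsub' hq'W'
    have hq'C : q' ∉ C := fun h => hq'W (hCW h)
    have hq : rk N ((gr N).erase q') = rk N (gr N) := by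
      have := hspan' W' hW'Dv {q'} (singleton_subset_iff.2 hq'W')
      rwa [sdiff_singleton_eq_erase] at this
    obtain ⟨hta', htb', htab⟩ := hta q' hq'V hq'C hq
    rw [mem_filter] at hta' htb'
    -- `W' ∩ W = C + σ` with `σ ∈ {p, q}`
    have hsig : p ∈ W' ∨ q ∈ W' := by
      by_contra hno
      have hno := not_or.1 hno
      have hsubI : W' ∩ W ⊆ C := by
        intro a ha
        rw [mem_inter] at ha
        by_contra haC
        have : a ∈ W \ C := mem_sdiff.2 ⟨ha.2, haC⟩
        rw [hWC, mem_insert, mem_singleton] at this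
        rcases this with rfl | rfl
        · exact hno.1 ha.1
        · exact hno.2 ha.1
      have := card_le_card hsubI
      omega
    -- the image for a valid point `t`
    have himg : ∀ t ∈ (gr N).erase x \ V, t ∉ clF N (V.erase q') →
        ((gr N).erase x \ ({q'} ∪ (((gr N).erase x \ V).erase t))) ∈
          Uw.filter (fun V' => (V' ∩ ((gr N).erase x \ V)).card = 1) ∧
        V \ ((gr N).erase x \ ({q'} ∪ (((gr N).erase x \ V).erase t))) = {q'} ∧
        ((gr N).erase x \ ({q'} ∪ (((gr N).erase x \ V).erase t))) \ V = {t} := by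
      intro t htT htcl
      have htV : t ∉ V := hTV t htT
      have htg : t ∈ gr N := hTg htT
      have hq'T : q' ∉ (gr N).erase x \ V := fun h => hTV q' h hq'V
      have hT'S : {q'} ∪ (((gr N).erase x \ V).erase t) ⊆ (gr N).erase x \ W := by
        intro a ha
        rw [mem_union, mem_singleton, mem_erase] at ha
        rcases ha with rfl | ⟨_, haT⟩
        · exact mem_sdiff.2 ⟨hVE hq'V, hq'W⟩
        · exact mem_sdiff.2 ⟨(mem_sdiff.1 haT).1, hTW a haT⟩
      have hT'ν : ({q'} ∪ (((gr N).erase x \ V).erase t)).card = ν := by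
        rw [card_union_of_disjoint, card_singleton, card_erase_of_mem htT, hTν]
        · omega
        rw [disjoint_left]
        intro a ha hb
        rw [mem_singleton] at ha
        rw [ha, mem_erase] at hb
        exact hq'T hb.2
      have hrk : rk N (gr N) ≤ rk N (gr N \ ({q'} ∪ (((gr N).erase x \ V).erase t))) + 1 := by
        have hsub2 : insert t (V.erase q') ⊆ gr N \ ({q'} ∪ (((gr N).erase x \ V).erase t)) := by
          intro a ha
          rw [mem_insert, mem_erase] at ha
          rw [mem_sdiff, mem_union, mem_singleton, mem_erase]
          rcases ha with rfl | ⟨haq, haV⟩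
          · exact ⟨htg, fun h => by rcases h with h | h; exact htV (h ▸ hq'V); exact h.1 rfl⟩
          · exact ⟨hVg haV, fun h => by rcases h with h | h; exact haq h; exact (mem_sdiff.1 h.2).2 haV⟩
        have h1 := rk_le_rk_of_subset_finset (M := N) hsub2
        have h2 : rk N (insert t (V.erase q')) = rk N (V.erase q') + 1 := by
          rw [rk_insert_eq htg ((erase_subset _ _).trans hVg), if_neg htcl]
        have h3 : rk N (V.erase q') = V.card - 1 := by
          rw [rk_eq_card_of_subset_of_rk_eq_card (erase_subset _ _) hVrk, card_erase_of_mem hq'V]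
        omega
      have htx : t ≠ x := (mem_erase.1 (mem_sdiff.1 htT).1).1
      have htq : t ≠ q' := fun h => htV (h ▸ hq'V)
      have hq'x : q' ≠ x := fun h => hxV (h ▸ hq'V)
      refine ⟨?_, ?_, ?_⟩
      · rw [mem_filter]
        refine ⟨hunit' _ hT'S hT'ν hrk, ?_⟩
        have e : ((gr N).erase x \ ({q'} ∪ (((gr N).erase x \ V).erase t))) ∩ ((gr N).erase x \ V) = {t} := by
          ext a
          simp only [mem_inter, mem_sdiff, mem_union, mem_singleton, mem_erase]
          constructor
          · rintro ⟨⟨_, h⟩, haE, haV⟩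
            by_contra hat
            exact h (Or.inr ⟨hat, haE, haV⟩)
          · rintro rfl
            exact ⟨⟨⟨htx, htg⟩, fun h => by rcases h with h | h; exact htq h; exact h.1 rfl⟩,
              ⟨htx, htg⟩, htV⟩
        rw [e, card_singleton]
      · ext a
        simp only [mem_sdiff, mem_union, mem_singleton, mem_erase]
        constructor
        · rintro ⟨haV, h⟩
          by_contra haq
          exact h ⟨⟨fun h' => hxV (h' ▸ haV), hVg haV⟩,
            fun h' => by rcases h' with h' | h'; exact haq h'; exact h'.2.2 haV⟩
        · rintro rfl
          exact ⟨hq'V, fun h => h.2 (Or.inl rfl)⟩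
      · ext a
        simp only [mem_sdiff, mem_union, mem_singleton, mem_erase]
        constructor
        · rintro ⟨⟨haE, h⟩, haV⟩
          by_contra hat
          exact h (Or.inr ⟨hat, haE, haV⟩)
        · rintro rfl
          exact ⟨⟨⟨htx, htg⟩, fun h => by rcases h with h | h; exact htq h; exact h.1 rfl⟩, htV⟩
    rcases hsig with hp | hq
    · obtain ⟨hmem, e1, e2⟩ := himg (ta q') hta'.1 hta'.2
      exact ⟨_, hmem, q', hq', e1, Or.inl ⟨hp, e2⟩⟩
    · obtain ⟨hmem, e1, e2⟩ := himg (tb q') htb'.1 htb'.2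
      exact ⟨_, hmem, q', hq', e1, Or.inr ⟨hq, e2⟩⟩
  · intro V' hV' W₁ hW₁ W₂ hW₂
    simp only [Set.mem_setOf_eq, mem_filter] at hW₁ hW₂
    obtain ⟨⟨hW₁Dv, hne₁, h4₁⟩, q₁, hq₁, hVq₁, hσ₁⟩ := hW₁
    obtain ⟨⟨hW₂Dv, hne₂, h4₂⟩, q₂, hq₂, hVq₂, hσ₂⟩ := hW₂
    have hq12 : q₁ = q₂ := by
      have : ({q₁} : Finset α) = {q₂} := by rw [← hVq₁, ← hVq₂]
      exact singleton_injective this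
    subst hq12
    obtain ⟨hCW₁, hc₁, hsub₁, _⟩ := hdem' W₁ hW₁Dv
    obtain ⟨hCW₂, hc₂, hsub₂, _⟩ := hdem' W₂ hW₂Dv
    have hq₁W : q₁ ∉ W := (mem_sdiff.1 (hq₁ ▸ mem_singleton_self q₁)).2
    have hq₁V : q₁ ∈ V := hsub₁ (mem_sdiff.1 (hq₁ ▸ mem_singleton_self q₁)).1
    have hq₁C : q₁ ∉ C := fun h => hq₁W (hCW h)
    have hqr : rk N ((gr N).erase q₁) = rk N (gr N) := by
      have := hspan' W₁ hW₁Dv {q₁} (singleton_subset_iff.2 (mem_sdiff.1 (hq₁ ▸ mem_singleton_self q₁)).1)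
      rwa [sdiff_singleton_eq_erase] at this
    obtain ⟨_, _, htab⟩ := hta q₁ hq₁V hq₁C hqr
    -- the same `σ` on both sides
    have hsame : (p ∈ W₁ ∧ p ∈ W₂) ∨ (q ∈ W₁ ∧ q ∈ W₂) := by
      rcases hσ₁ with ⟨hp₁, e₁⟩ | ⟨hq₁', e₁⟩ <;> rcases hσ₂ with ⟨hp₂, e₂⟩ | ⟨hq₂', e₂⟩
      · exact Or.inl ⟨hp₁, hp₂⟩
      · exfalso; apply htab; exact singleton_injective (e₁.symm.trans e₂)
      · exfalso; apply htab; exact singleton_injective (e₂.symm.trans e₁)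
      · exact Or.inr ⟨hq₁', hq₂'⟩
    -- `W_i = C + σ + q₁`
    have hshape : ∀ W' ∈ Dv, (W' ∩ W).card = ν - 1 → W' \ W = {q₁} → ∀ σ, σ ∈ W' → σ ∈ W \ C →
        W' = insert q₁ (insert σ C) := by
      intro W' hW'Dv h4 hq'eq σ hσW' hσWC
      obtain ⟨hCW', hc', _, _⟩ := hdem' W' hW'Dv
      have hsubI : insert σ C ⊆ W' ∩ W :=
        insert_subset (mem_inter.2 ⟨hσW', (mem_sdiff.1 hσWC).1⟩) (subset_inter hCW' hCW)
      have hcardI : (insert σ C).card = ν - 1 := by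
        rw [card_insert_of_notMem (mem_sdiff.1 hσWC).2, hC]
        omega
      have hIeq : W' ∩ W = insert σ C := (eq_of_subset_of_card_le hsubI (by omega)).symm
      have e := sdiff_union_inter W' W
      rw [hq'eq, hIeq] at e
      rw [← e]
      ext a
      simp only [mem_union, mem_singleton, mem_insert]
    rcases hsame with ⟨hp₁, hp₂⟩ | ⟨hq₁', hq₂'⟩
    · rw [hshape W₁ hW₁Dv h4₁ hq₁ p hp₁ (hWC ▸ mem_insert_self p {q}),
        hshape W₂ hW₂Dv h4₂ hq₂ p hp₂ (hWC ▸ mem_insert_self p {q})]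
    · rw [hshape W₁ hW₁Dv h4₁ hq₁ q hq₁' (hWC ▸ mem_insert_of_mem (mem_singleton_self q)),
        hshape W₂ hW₂Dv h4₂ hq₂ q hq₂' (hWC ▸ mem_insert_of_mem (mem_singleton_self q))]




end GenericTwoIII

end PercRepro.Cogirth
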